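import Literature.Computability.AlgebraicComplexity.PencilRankKroneckerCanonicalForm
import HarnessLib

/-!
# Ja'Ja''s maximal rank of `(m, n, 2)`-tensors, `maxrank(m,n,2) = min(m + ⌊n/2⌋, 2m)` (`m ≤ n`):
# the value is attained (Sumi–Miyazaki–Sakata 2009, Thm. 15; BCS Ex. 19.12)

Topic `Literature/Computability/AlgebraicComplexity` (bilinear complexity; rank of matrix pencils).
Sequel to `PencilRankKroneckerCanonicalForm.lean` (`BCS1997_thm_19_4`: the rank of a pencil in
Weierstraß–Kronecker canonical form) and `PencilRankVersusBorderRank.lean`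
(`BCS1997_ex_19_12_lower`: the square case `m = n`). Sources: T. Sumi, M. Miyazaki, T. Sakata,
*Rank of 3-tensors with 2 slices and Kronecker canonical forms*, LAA 431 (2009), arXiv:0808.1167
(held text `paper:arxiv-0808.1167`, read 2026-08-27), p. 6: "Now we recall that the maximal rank
of tensors with 2 slices was given by the following theorem. Theorem 15 (cf. [JaJa:1979b]).
`maxrank_𝔽(m,n,2) = min(n + ⌊m/2⌋, m + ⌊n/2⌋, 2m, 2n)`." (`𝔽 = ℝ, ℂ` there); P. Bürgisser,
M. Clausen, M. A. Shokrollahi, *Algebraic Complexity Theory* (1997), Ex. 19.12 (the case `m = n`).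

For `m ≤ n` the printed minimum is `m + ⌊n/2⌋` when `n ≤ 2m` and `2m` when `n ≥ 2m`.

## What is proved

* **`exists_pencil_tensorRank_eq_add_div_two`** — for `m ≤ n ≤ 2m` there is a tensor
  `t : Fin m → Fin n → Fin 2 → K` with `m + ⌊n/2⌋ ≤ R(t)` over EVERY field, and
  `R(t) = m + ⌊n/2⌋` as soon as `|K| ≥ m`: the canonical form
  `⊞^{n−m} ℜ₁ ⊞ ⊞^{b} 𝔍_{2,0} ⊞ ⊞^{c} 𝔍_{1,0}` (`2b + c = 2m − n`, `c ≤ 1`), evaluated by Thm. (19.4)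
  and relabelled to `Fin m × Fin n`.

* `tensorRank_le_card_mul_card` (`R(t) ≤ |ι|·|μ|`), `tensorRank_fin_two_le_two_mul` (every
  `(m,n,2)`-tensor has `R ≤ 2m`), **`exists_pencil_tensorRank_eq_two_mul`** (for `n ≥ 2m` a tensor
  of rank exactly `2m` over EVERY field: `⊞^m ℜ₁` padded with `n − 2m` zero columns) and
  **`SumiMiyazakiSakata2008_thm_15_of_two_mul_le`** — Theorem 15 in full in the range `n ≥ 2m`
  (`maxrank(m,n,2) = 2m`), over every field.

* **`exists_pencil_tensorRank_eq_maxrank`** — over every INFINITE field and for all `m, n` there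
  is an `(m,n,2)`-tensor of rank exactly `min(n + ⌊m/2⌋, m + ⌊n/2⌋, 2m, 2n)` (the two cases above
  plus transposition `tensorRank_swap₁₂`): the attainment half of Theorem 15 as printed.

* `tensorRank_le_card_mul_card₂₃` (the `(κ, μ)` bound; the `(ι, κ)` one is the tree's
  `tensorRank_le_card_mul_card₁₂` in `UnitTensorMomentPolytopeProofs.lean`), `tensorRank_fin_two_le_min`
  (`R ≤ min(2m, 2n)` for every `(m,n,2)`-tensor) and `SumiMiyazakiSakata2008_thm_15_of_two_mul_le'`
  (Theorem 15 in full for `m ≥ 2n`, every field).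

* `exists_pencil_maxrank_le_tensorRank` — over EVERY field some `(m,n,2)`-tensor has rank
  `≥ min(n + ⌊m/2⌋, m + ⌊n/2⌋, 2m, 2n)`.

Not typed: the upper bound `R ≤ m + ⌊n/2⌋` for ALL pencils when `m ≤ n < 2m` (it needs the
Kronecker canonical form (19.3)).

Theorem-only file: no definitions, no named facts.

## References

* [SumiMiyazakiSakata2008] T. Sumi, M. Miyazaki, T. Sakata, LAA 431 (2009) 1858–1868,
  arXiv:0808.1167 — Thm. 15 (p. 6 of the arXiv text).
* [BurgisserClausenShokrollahi1997] P. Bürgisser, M. Clausen, M. A. Shokrollahi, *Algebraic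
  Complexity Theory*, Springer 1997 — Thm. (19.4), Ex. 19.12.
-/

noncomputable section

open scoped BigOperators
open Module Finset Matrix

namespace Literature.Computability.AlgebraicComplexity

namespace MatrixPencil

section PartTwentyFour

universe u24

variable {K : Type u24} [Field K]

/-! ### Ja'Ja''s maximal rank `maxrank(m, n, 2) = min(m + ⌊n/2⌋, 2m)` (`m ≤ n`): attainment -/

/-- Rank is invariant under relabelling the coordinates along bijections. [folklore] -/
private theorem tensorRank_precomp_equiv' {ι κ μ ι' κ' μ' : Type*} [Fintype ι] [Fintype κ]
    [Fintype μ] [Fintype ι'] [Fintype κ'] [Fintype μ'] [DecidableEq ι] [DecidableEq κ]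
    [DecidableEq μ] [DecidableEq ι'] [DecidableEq κ'] [DecidableEq μ'] (t : ι → κ → μ → K)
    (e₁ : ι' ≃ ι) (e₂ : κ' ≃ κ) (e₃ : μ' ≃ μ) :
    tensorRank (fun a b c => t (e₁ a) (e₂ b) (e₃ c)) = tensorRank t :=
  le_antisymm (tensorRestrictsTo_precomp t e₁ e₂ e₃).tensorRank_le
    (tensorRestrictsTo_of_reindex t e₁ e₂ e₃).tensorRank_le

/-- `∑ₖ sizeₖ` and `#{k : sizeₖ ≥ 2}` for the sizes `2, …, 2` (`b` times), `1, …, 1` (`c` times).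
[folklore] -/
private theorem sum_sizes_two_one (b c : ℕ) :
    ∑ k : Fin (b + c), (if (k : ℕ) < b then 2 else 1) = 2 * b + c ∧
      (Finset.univ.filter fun k : Fin (b + c) => 2 ≤ (if (k : ℕ) < b then 2 else 1)).card = b := by
  constructor
  · rw [Fin.sum_univ_add]
    have h1 : ∀ i : Fin b, (fun k : Fin (b + c) => if (k : ℕ) < b then 2 else 1) (Fin.castAdd c i) = 2 :=
      fun i => by simp
    have h2 : ∀ i : Fin c, (fun k : Fin (b + c) => if (k : ℕ) < b then 2 else 1) (Fin.natAdd b i) = 1 :=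
      fun i => by simp
    simp only [h1, h2, Finset.sum_const, Finset.card_univ, Fintype.card_fin, smul_eq_mul, mul_one]
    ring
  · rw [Finset.card_filter, Fin.sum_univ_add]
    simp

/-- **Attainment of Ja'Ja''s maximal rank for `m ≤ n ≤ 2m`**: there is a pencil of type `(m, n)` of
rank `m + ⌊n/2⌋` (`= min(n + ⌊m/2⌋, m + ⌊n/2⌋, 2m, 2n)` in this range) — the canonical form
`⊞^{n−m} ℜ₁ ⊞ ⊞^{b} 𝔍_{2,0} ⊞ ⊞^{c} 𝔍_{1,0}` with `2b + c = 2m − n`, `c ≤ 1`, whose rank is given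
by Thm. (19.4) (`BCS1997_thm_19_4`); the lower bound `≥` holds over every field, the exact value
needs `|K| ≥ m`. ("Theorem 15 (cf. [JaJa 1979b]). `maxrank_𝔽(m,n,2) = min(n + ⌊m/2⌋, m + ⌊n/2⌋,
2m, 2n)`." — the upper bound needs the Kronecker canonical form and is not typed.)
[cite: SumiMiyazakiSakata2008, Thm. 15; BurgisserClausenShokrollahi1997, Thm. (19.4) and Ex. 19.12] -/
theorem exists_pencil_tensorRank_eq_add_div_two {m n : ℕ} (hmn : m ≤ n) (hn : n ≤ 2 * m) :
    ∃ t : Fin m → Fin n → Fin 2 → K, m + n / 2 ≤ tensorRank t ∧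
      ((∃ α : Fin m → K, Function.Injective α) → tensorRank t = m + n / 2) := by
  classical
  -- block counts
  set a := n - m with ha
  set b := (2 * m - n) / 2 with hb
  set c := (2 * m - n) % 2 with hc
  have hs : 2 * b + c = 2 * m - n := Nat.div_add_mod (2 * m - n) 2
  set nn : Fin (b + c) → ℕ := fun k => if (k : ℕ) < b then 2 else 1 with hnn
  set av : Fin (b + c) → K := fun _ => 0 with hav
  set ε : Fin 0 → ℕ := fun _ => 1 with hε
  set η : Fin a → ℕ := fun _ => 1 with hη
  have hsz := sum_sizes_two_one b c
  have hsum : ∑ k, nn k = 2 * b + c := hsz.1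
  -- the canonical form and its rank
  set T := kroneckerForm nn av ε η with hT
  have hsup : Finset.univ.sup (fun k₀ : Fin (b + c) =>
      (Finset.univ.filter fun k => av k = av k₀ ∧ 2 ≤ nn k).card) = b := by
    have hfun : (fun k₀ : Fin (b + c) => (Finset.univ.filter fun k => av k = av k₀ ∧ 2 ≤ nn k).card) =
        fun _ => b := by
      funext k₀
      have : (Finset.univ.filter fun k => av k = av k₀ ∧ 2 ≤ nn k) =
          Finset.univ.filter fun k : Fin (b + c) => 2 ≤ nn k := by
        refine Finset.filter_congr fun k _ => ?_
        simp [hav]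
      rw [this]
      exact hsz.2
    rw [hfun]
    refine le_antisymm (Finset.sup_le fun _ _ => le_rfl) ?_
    by_cases hb0 : b = 0
    · rw [hb0]; exact Nat.zero_le _
    · exact Finset.le_sup (f := fun _ : Fin (b + c) => b) (Finset.mem_univ ⟨0, by omega⟩)
  have hval : ∑ i, (ε i + 1) + ∑ j, (η j + 1) + (∑ k, nn k +
      Finset.univ.sup (fun k₀ : Fin (b + c) =>
        (Finset.univ.filter fun k => av k = av k₀ ∧ 2 ≤ nn k).card)) = m + n / 2 := by
    rw [hsup, hsum]
    simp only [Finset.univ_eq_empty, Finset.sum_empty, hη, Finset.sum_const, Finset.card_univ,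
      Fintype.card_fin, smul_eq_mul, zero_add]
    omega
  have hlow : m + n / 2 ≤ tensorRank T := by
    rw [← hval]
    exact le_tensorRank_kroneckerForm nn av ε η (fun i => Fin.elim0 i) (fun _ => le_rfl)
  have hup : (∃ α : Fin m → K, Function.Injective α) → tensorRank T = m + n / 2 := by
    rintro ⟨α, hα⟩
    have hcast : ∑ k, nn k + ∑ i, ε i + ∑ j, η j = m := by
      rw [hsum]
      simp only [Finset.univ_eq_empty, Finset.sum_empty, hη, Finset.sum_const, Finset.card_univ,
        Fintype.card_fin, smul_eq_mul, mul_one, add_zero]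
      omega
    rw [← hval]
    exact BCS1997_thm_19_4 nn av ε η (fun i => Fin.elim0 i) (fun _ => le_rfl)
      (fun x => α (Fin.cast hcast x)) (hα.comp (Fin.cast_injective hcast))
  -- relabel rows by `Fin m`, columns by `Fin n`
  have hrows : Fintype.card (Fin m) =
      Fintype.card ((((Σ k, Fin (nn k)) ⊕ (Σ i : Fin 0, Fin (ε i + 1))) ⊕ (Σ j : Fin a, Fin (η j)))) := by
    simp only [Fintype.card_fin, Fintype.card_sum, Fintype.card_sigma, Finset.univ_eq_empty,
      Finset.sum_empty, add_zero, hη, Finset.sum_const, Finset.card_univ, smul_eq_mul, mul_one]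
    rw [hsum]
    omega
  have hcols : Fintype.card (Fin n) =
      Fintype.card ((((Σ k, Fin (nn k)) ⊕ (Σ i : Fin 0, Fin (ε i))) ⊕ (Σ j : Fin a, Fin (η j + 1)))) := by
    simp only [Fintype.card_fin, Fintype.card_sum, Fintype.card_sigma, Finset.univ_eq_empty,
      Finset.sum_empty, add_zero, hη, Finset.sum_const, Finset.card_univ, smul_eq_mul]
    rw [hsum]
    omega
  let eR := Fintype.equivOfCardEq hrows
  let eC := Fintype.equivOfCardEq hcols
  refine ⟨fun x y l => T (eR x) (eC y) (Equiv.refl (Fin 2) l), ?_, ?_⟩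
  · rw [tensorRank_precomp_equiv']; exact hlow
  · intro hK; rw [tensorRank_precomp_equiv']; exact hup hK

end PartTwentyFour

section PartTwentyFive

universe u25

variable {K : Type u25} [Field K]

/-! ### `maxrank(m, n, 2) = 2m` for `n ≥ 2m`, over every field -/

/-- **The trivial bound `R(t) ≤ |ι|·|μ|`** (slice `t` along the first and third index: `t = ∑_{i,l}
e_i ⊗ t(i,·,l) ⊗ e_l`); for `(m, n, 2)`-tensors this is the term `2m` (and, by symmetry, `2n`) in
Ja'Ja''s `maxrank(m,n,2) = min(n + ⌊m/2⌋, m + ⌊n/2⌋, 2m, 2n)`.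
[cite: Blaser2013, §4 (a tensor is the sum of its fibres); SumiMiyazakiSakata2008, Thm. 15 (the terms `2m`, `2n` of the minimum are these slicing bounds)] -/
theorem tensorRank_le_card_mul_card {ι κ μ : Type*} [Fintype ι] [Fintype κ] [Fintype μ]
    [DecidableEq ι] [DecidableEq κ] [DecidableEq μ] (t : ι → κ → μ → K) :
    tensorRank t ≤ Fintype.card ι * Fintype.card μ := by
  classical
  rw [← Fintype.card_prod]
  refine tensorRank_le_card_of_eq_sum (σ := ι × μ) (fun s i => if i = s.1 then (1 : K) else 0)
    (fun s j => t s.1 j s.2) (fun s l => if l = s.2 then (1 : K) else 0) ?_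
  funext i j l
  rw [Finset.sum_apply, Finset.sum_apply, Finset.sum_apply]
  simp only [triad_apply]
  rw [Finset.sum_eq_single (i, l)]
  · simp
  · rintro ⟨i', l'⟩ _ hne
    by_cases hi : i = i'
    · subst hi
      have hl : l ≠ l' := fun h => hne (by rw [h])
      simp [hl]
    · simp [hi]
  · exact fun h => absurd (Finset.mem_univ _) h

/-- Every `(m, n, 2)`-tensor has rank `≤ 2m`. [cite: SumiMiyazakiSakata2008, Thm. 15] -/
theorem tensorRank_fin_two_le_two_mul (m n : ℕ) (t : Fin m → Fin n → Fin 2 → K) :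
    tensorRank t ≤ 2 * m := by
  have h := tensorRank_le_card_mul_card t
  simp only [Fintype.card_fin] at h
  omega

/-- **`maxrank(m, n, 2) = 2m` for `n ≥ 2m`, over every field**: the bound `2m` is attained by
`⊞^m ℜ₁` (`m × 2m`, rank `2m` by Thm. (19.4) / Prop. (19.9)) padded with `n − 2m` zero columns;
with `tensorRank_fin_two_le_two_mul` this is Ja'Ja''s formula in the range `n ≥ 2m`.
[cite: SumiMiyazakiSakata2008, Thm. 15; BurgisserClausenShokrollahi1997, Thm. (19.4)] -/
theorem exists_pencil_tensorRank_eq_two_mul {m n : ℕ} (hn : 2 * m ≤ n) :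
    ∃ t : Fin m → Fin n → Fin 2 → K, tensorRank t = 2 * m := by
  classical
  set nn : Fin 0 → ℕ := fun _ => 1 with hnn
  set av : Fin 0 → K := fun _ => 0 with hav
  set ε : Fin 0 → ℕ := fun _ => 1 with hε
  set η : Fin m → ℕ := fun _ => 1 with hη
  set T := kroneckerForm nn av ε η with hT
  have hlow : 2 * m ≤ tensorRank T := by
    have h := le_tensorRank_kroneckerForm nn av ε η (fun i => Fin.elim0 i) (fun _ => le_rfl)
    have hs : ∑ j, (η j + 1) = 2 * m := by simp [hη]; ring
    have he1 : ∑ i, (ε i + 1) = 0 := by simp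
    have he2 : ∑ k, nn k = 0 := by simp
    have he3 : Finset.univ.sup (fun k₀ : Fin 0 =>
        (Finset.univ.filter fun k => av k = av k₀ ∧ 2 ≤ nn k).card) = 0 := by simp
    rw [hs, he1, he2, he3] at h
    simpa using h
  -- pad with `n − 2m` zero columns
  let T' : (((Σ k : Fin 0, Fin (nn k)) ⊕ (Σ i : Fin 0, Fin (ε i + 1))) ⊕ (Σ j : Fin m, Fin (η j))) →
      ((((Σ k : Fin 0, Fin (nn k)) ⊕ (Σ i : Fin 0, Fin (ε i))) ⊕ (Σ j : Fin m, Fin (η j + 1))) ⊕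
        Fin (n - 2 * m)) → Fin 2 → K :=
    fun x y l => Sum.elim (fun y₁ => T x y₁ l) (fun _ => 0) y
  have hres : TensorRestrictsTo T' T := by
    have h := tensorRestrictsTo_precomp T' id Sum.inl id
    exact h
  have hlow' : 2 * m ≤ tensorRank T' := hlow.trans hres.tensorRank_le
  have hup' : tensorRank T' ≤ 2 * m := by
    refine (tensorRank_le_card_mul_card T').trans ?_
    simp [Fintype.card_sum, Fintype.card_sigma, hη]
    omega
  have hrows : Fintype.card (Fin m) =
      Fintype.card (((Σ k : Fin 0, Fin (nn k)) ⊕ (Σ i : Fin 0, Fin (ε i + 1))) ⊕ (Σ j : Fin m, Fin (η j))) := by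
    simp [Fintype.card_sum, Fintype.card_sigma, hη]
  have hcols : Fintype.card (Fin n) =
      Fintype.card ((((Σ k : Fin 0, Fin (nn k)) ⊕ (Σ i : Fin 0, Fin (ε i))) ⊕ (Σ j : Fin m, Fin (η j + 1))) ⊕
        Fin (n - 2 * m)) := by
    simp [Fintype.card_sum, Fintype.card_sigma, hη]
    omega
  let eR := Fintype.equivOfCardEq hrows
  let eC := Fintype.equivOfCardEq hcols
  refine ⟨fun x y l => T' (eR x) (eC y) (Equiv.refl (Fin 2) l), ?_⟩
  rw [tensorRank_precomp_equiv']
  exact le_antisymm hup' hlow'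

/-- **Ja'Ja''s `maxrank(m, n, 2)` for `n ≥ 2m`, in full, over every field**: every `(m,n,2)`-tensor
has rank `≤ 2m` and some has rank `2m`. [cite: SumiMiyazakiSakata2008, Thm. 15] -/
theorem SumiMiyazakiSakata2008_thm_15_of_two_mul_le {m n : ℕ} (hn : 2 * m ≤ n) :
    (∀ t : Fin m → Fin n → Fin 2 → K, tensorRank t ≤ 2 * m) ∧
      ∃ t : Fin m → Fin n → Fin 2 → K, tensorRank t = 2 * m :=
  ⟨tensorRank_fin_two_le_two_mul m n, exists_pencil_tensorRank_eq_two_mul hn⟩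

end PartTwentyFive

section PartTwentySix

universe u26

variable {K : Type u26} [Field K]

/-- **Ja'Ja''s maximal rank is attained, all formats, over every infinite field**: for every
`m, n` there is an `(m, n, 2)`-tensor of rank `min(n + ⌊m/2⌋, m + ⌊n/2⌋, 2m, 2n)` (the printed
`maxrank_𝔽(m,n,2)`, `𝔽 = ℝ, ℂ`); by `exists_pencil_tensorRank_eq_add_div_two` /
`exists_pencil_tensorRank_eq_two_mul` and transposition. (That no `(m,n,2)`-tensor exceeds this
value is typed only for `n ≥ 2m` / `m ≥ 2n`: `tensorRank_fin_two_le_two_mul`.)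
[cite: SumiMiyazakiSakata2008, Thm. 15] -/
theorem exists_pencil_tensorRank_eq_maxrank [Infinite K] (m n : ℕ) :
    ∃ t : Fin m → Fin n → Fin 2 → K,
      tensorRank t = min (min (n + m / 2) (m + n / 2)) (min (2 * m) (2 * n)) := by
  have hα : ∀ k : ℕ, ∃ α : Fin k → K, Function.Injective α := fun k =>
    ⟨fun i => Infinite.natEmbedding K i,
      (Infinite.natEmbedding K).injective.comp Fin.val_injective⟩
  -- the case `m ≤ n`
  have main : ∀ m n : ℕ, m ≤ n → ∃ t : Fin m → Fin n → Fin 2 → K,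
      tensorRank t = min (min (n + m / 2) (m + n / 2)) (min (2 * m) (2 * n)) := by
    intro m n hmn
    rcases le_total n (2 * m) with h2 | h2
    · obtain ⟨t, -, ht⟩ := exists_pencil_tensorRank_eq_add_div_two (K := K) hmn h2
      refine ⟨t, ?_⟩
      rw [ht (hα m)]
      omega
    · obtain ⟨t, ht⟩ := exists_pencil_tensorRank_eq_two_mul (K := K) h2
      refine ⟨t, ?_⟩
      rw [ht]
      omega
  rcases le_total m n with hmn | hnm
  · exact main m n hmn
  · obtain ⟨t, ht⟩ := main n m hnm
    refine ⟨fun a b c => t b a c, ?_⟩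
    rw [tensorRank_swap₁₂ t, ht]
    omega

end PartTwentySix

section PartTwentyEight

universe u28

variable {K : Type u28} [Field K]

/-! ### The other two trivial bounds and Theorem 15 for `m ≥ 2n` -/

/-- `R(t) ≤ |κ|·|μ|` (slicing along the first factor). The `(ι, κ)` version is the tree's
`tensorRank_le_card_mul_card₁₂` (`UnitTensorMomentPolytopeProofs.lean`, Bläser 2013 §4).
[cite: Blaser2013, §4; SumiMiyazakiSakata2008, Thm. 15 (the terms `2m`, `2n`)] -/
theorem tensorRank_le_card_mul_card₂₃ {ι κ μ : Type*} [Fintype ι] [Fintype κ] [Fintype μ]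
    [DecidableEq ι] [DecidableEq κ] [DecidableEq μ] (t : ι → κ → μ → K) :
    tensorRank t ≤ Fintype.card κ * Fintype.card μ := by
  rw [← tensorRank_rotate t, ← tensorRank_rotate (rotate t), mul_comm]
  exact tensorRank_le_card_mul_card (rotate (rotate t))

/-- Every `(m, n, 2)`-tensor has rank `≤ min(2m, 2n)`. [cite: SumiMiyazakiSakata2008, Thm. 15] -/
theorem tensorRank_fin_two_le_min (m n : ℕ) (t : Fin m → Fin n → Fin 2 → K) :
    tensorRank t ≤ min (2 * m) (2 * n) := by
  have h1 := tensorRank_le_card_mul_card t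
  have h2 := tensorRank_le_card_mul_card₂₃ t
  simp only [Fintype.card_fin] at h1 h2
  exact le_min (by omega) (by omega)

/-- **Theorem 15 in full for `m ≥ 2n`, over every field**: every `(m,n,2)`-tensor has rank `≤ 2n`
and some has rank `2n` (transpose of `exists_pencil_tensorRank_eq_two_mul`).
[cite: SumiMiyazakiSakata2008, Thm. 15] -/
theorem SumiMiyazakiSakata2008_thm_15_of_two_mul_le' {m n : ℕ} (hm : 2 * n ≤ m) :
    (∀ t : Fin m → Fin n → Fin 2 → K, tensorRank t ≤ 2 * n) ∧
      ∃ t : Fin m → Fin n → Fin 2 → K, tensorRank t = 2 * n := by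
  refine ⟨fun t => (tensorRank_fin_two_le_min m n t).trans (min_le_right _ _), ?_⟩
  obtain ⟨t, ht⟩ := exists_pencil_tensorRank_eq_two_mul (K := K) hm
  exact ⟨fun a b c => t b a c, by rw [tensorRank_swap₁₂ t, ht]⟩

end PartTwentyEight

section PartThirty

universe u30

variable {K : Type u30} [Field K]

/-- **Ja'Ja''s maximal rank is reached or exceeded over EVERY field**: for all `m, n` some
`(m,n,2)`-tensor has rank `≥ min(n + ⌊m/2⌋, m + ⌊n/2⌋, 2m, 2n)` (the lower bounds of
`exists_pencil_tensorRank_eq_add_div_two` / `exists_pencil_tensorRank_eq_two_mul` need no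
field-size hypothesis). [cite: SumiMiyazakiSakata2008, Thm. 15; BurgisserClausenShokrollahi1997, Thm. (19.4)] -/
theorem exists_pencil_maxrank_le_tensorRank (m n : ℕ) :
    ∃ t : Fin m → Fin n → Fin 2 → K,
      min (min (n + m / 2) (m + n / 2)) (min (2 * m) (2 * n)) ≤ tensorRank t := by
  have main : ∀ m n : ℕ, m ≤ n → ∃ t : Fin m → Fin n → Fin 2 → K,
      min (min (n + m / 2) (m + n / 2)) (min (2 * m) (2 * n)) ≤ tensorRank t := by
    intro m n hmn
    rcases le_total n (2 * m) with h2 | h2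
    · obtain ⟨t, ht, -⟩ := exists_pencil_tensorRank_eq_add_div_two (K := K) hmn h2
      exact ⟨t, le_trans (by omega) ht⟩
    · obtain ⟨t, ht⟩ := exists_pencil_tensorRank_eq_two_mul (K := K) h2
      exact ⟨t, by rw [ht]; omega⟩
  rcases le_total m n with hmn | hnm
  · exact main m n hmn
  · obtain ⟨t, ht⟩ := main n m hnm
    refine ⟨fun a b c => t b a c, ?_⟩
    rw [tensorRank_swap₁₂ t]
    exact le_trans (by omega) ht

end PartThirty

end MatrixPencil

end Literature.Computability.AlgebraicComplexity

end
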